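import Mathlib
import Literature.Analysis.Fourier.PeriodicModeCalculus
import Literature.Analysis.Fourier.TrigPolyC1Approximation
import HarnessLib

/-!
# Window modes of periodic functions: pointwise inversion, decay for `C²` functions, the modes of a
# product (convolution of modes), and differentiation / continuity in a parameter on an interval

Topic `Literature/Analysis/Fourier`. Companion of `PeriodicModeCalculus.lean` (the un-normalised window modes
`modeCoeff T m g = ∫₀ᵀ e_{−m}(φ) g(φ) dφ`, `e_n(φ) = fourier n (φ : AddCircle T) = e^{2πinφ/T}`, periodic
integration by parts, GLOBAL-in-parameter differentiation). Everything here is PROVED (no definitions, no named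
facts); the statements are the textbook facts below, written for functions `ℝ → ℂ` on the window `[0, T]`.

* `hasSum_modeCoeff_mul_fourier` — **pointwise Fourier inversion** for a continuous `T`-periodic `f` with
  `Σ_n ‖modeCoeff T n f‖ < ∞`: `f(x) = Σ_{n∈ℤ} T⁻¹ · modeCoeff T n f · e_n(x)` (Mathlib's
  `has_pointwise_sum_fourier_series_of_summable`, unwrapped) [cite: Katznelson2004, Ch. I §6.1 (functions in
  `A(𝕋)`: the Fourier series converges absolutely and uniformly to `f`)];
* `norm_modeCoeff_le_of_hasDerivAt_two`, `summable_norm_modeCoeff_of_hasDerivAt_two` — **decay**: for a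
  `T`-periodic `C²` function `‖modeCoeff T n f‖ ≤ (T/(2πn))² ∫₀ᵀ ‖f″‖` (`n ≠ 0`), hence the modes are absolutely
  summable [cite: Katznelson2004, Ch. I §4.4 Theorem (`|f̂(n)| ≤ ‖f^{(j)}‖_{L¹}/|n|^j`)];
* `hasSum_modeCoeff_mul` — **modes of a product = convolution of modes**: for `f` continuous `T`-periodic with
  summable modes and `g` continuous, `T · modeCoeff T m (f·g) = Σ_{l∈ℤ} modeCoeff T l f · modeCoeff T (m−l) g`
  (dominated convergence on the window) [cite: Katznelson2004, Ch. I §6.1 Lemma (`(fg)^(n) = Σ_k f̂(k)ĝ(n−k)` for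
  `f ∈ A(𝕋)`)];
* `hasDerivAt_modeCoeff_param_of_mem_Ioo` — **differentiation in a parameter, LOCAL version**: if
  `θ ↦ G θ φ` has derivative `Gθ θ φ` for `θ` in an open interval `(a, b)`, `G θ` is continuous for those `θ`, and
  `Gθ` is jointly continuous on `(a, b) × ℝ`, then `θ ↦ modeCoeff T m (G θ)` has derivative `modeCoeff T m (Gθ θ₀)`
  at every `θ₀ ∈ (a, b)`; `continuousOn_modeCoeff_param` — continuity of `θ ↦ modeCoeff T m (G θ)` on `[a, b]` from
  joint continuity of `G` on `[a, b] × ℝ` [cite: Folland1999, Thm. 2.27 (continuity and differentiation under the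
  integral sign)].

## Mathlib / tree search
Mathlib: `has_pointwise_sum_fourier_series_of_summable` (on `C(AddCircle T, ℂ)`), `fourierCoeff_eq_intervalIntegral`,
`intervalIntegral.hasSum_integral_of_dominated_convergence`, `intervalIntegral.hasDerivAt_integral_of_dominated_loc_of_deriv_le`,
`Real.summable_one_div_int_pow`. Tree: `PeriodicModeCalculus` (global-parameter version only; no product / decay /
inversion for `modeCoeff`), `TrigPolyC1Approximation.periodic_of_hasDerivAt` (used), `LipschitzFourierTail` (Bernstein: Lipschitz ⇒ `A(𝕋)`, on `AddCircle 1`, not used).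
-/

noncomputable section

open MeasureTheory Set Filter Real intervalIntegral Complex AddCircle
open scoped Topology

namespace Literature.Analysis.Fourier

variable {T : ℝ}

/-! ### Characters (private plumbing) -/

/-- Continuity of `x ↦ e_n(x)`. [folklore] -/
private theorem continuous_fourier_coe (n : ℤ) : Continuous fun x : ℝ => fourier n (x : AddCircle T) :=
  (map_continuous (fourier n)).comp (AddCircle.continuous_mk' T)

/-- `‖e_n(x)‖ = 1`. [folklore] -/
private theorem norm_fourier_coe (n : ℤ) (x : ℝ) : ‖fourier n (x : AddCircle T)‖ = 1 := by
  rw [fourier_coe_apply, show 2 * π * I * n * x / T = (((2 * π * n * x / T) : ℝ) : ℂ) * I by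
    push_cast; ring, Complex.norm_exp_ofReal_mul_I]

/-- `e_{−m}(x) · e_l(x) = e_{−(m − l)}(x)`. [folklore] -/
private theorem fourier_neg_mul_fourier (m l : ℤ) (x : ℝ) :
    fourier (-m) (x : AddCircle T) * fourier l (x : AddCircle T) = fourier (-(m - l)) (x : AddCircle T) := by
  rw [← fourier_add, show -m + l = -(m - l) by ring]

/-! ### Pointwise Fourier inversion -/

/-- **Pointwise Fourier inversion on the window.** For a continuous `T`-periodic `f : ℝ → ℂ` whose window modes are
absolutely summable, `f(x) = Σ_{n ∈ ℤ} T⁻¹ · modeCoeff T n f · e_n(x)` at every `x`.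
[cite: Katznelson2004, Ch. I §6.1 (absolutely convergent Fourier series converge uniformly to `f`)] -/
theorem hasSum_modeCoeff_mul_fourier [hT : Fact (0 < T)] {f : ℝ → ℂ} (hf : Continuous f)
    (hper : Function.Periodic f T) (hs : Summable fun n : ℤ => ‖modeCoeff T n f‖) (x : ℝ) :
    HasSum (fun n : ℤ => ((1 / T : ℝ) : ℂ) * modeCoeff T n f * fourier n (x : AddCircle T)) (f x) := by
  set F : C(AddCircle T, ℂ) := ⟨hper.lift, continuous_coinduced_dom.mpr hf⟩ with hF
  have hFx : ∀ y : ℝ, F (y : AddCircle T) = f y := fun y => rfl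
  have hcoeff : ∀ n : ℤ, fourierCoeff F n = ((1 / T : ℝ) : ℂ) * modeCoeff T n f := by
    intro n
    rw [fourierCoeff_eq_intervalIntegral F n 0, zero_add, modeCoeff, Complex.real_smul]
    congr 1
  have hsum : Summable (fourierCoeff F) := by
    have h1 : Summable fun n : ℤ => ((1 / T : ℝ) : ℂ) * modeCoeff T n f := (hs.of_norm).mul_left _
    exact h1.congr fun n => (hcoeff n).symm
  have h := has_pointwise_sum_fourier_series_of_summable hsum (x : AddCircle T)
  rw [hFx] at h
  have hfun : (fun n : ℤ => fourierCoeff F n • fourier n (x : AddCircle T))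
      = fun n => ((1 / T : ℝ) : ℂ) * modeCoeff T n f * fourier n (x : AddCircle T) := by
    funext n; rw [hcoeff, smul_eq_mul]
  rw [hfun] at h
  exact h

/-! ### Decay of the modes of a `C²` periodic function -/

/-- The mode of a continuous function is bounded by its `L¹` norm on the window: `‖modeCoeff T n g‖ ≤ ∫₀ᵀ ‖g‖`
(`|e_{−n}| = 1`). [cite: Katznelson2004, Ch. I §1.4 Theorem (e)] -/
theorem norm_modeCoeff_le_integral_norm (hT : 0 ≤ T) (n : ℤ) (g : ℝ → ℂ) :
    ‖modeCoeff T n g‖ ≤ ∫ x in (0 : ℝ)..T, ‖g x‖ := by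
  unfold modeCoeff
  refine (intervalIntegral.norm_integral_le_integral_norm hT).trans_eq ?_
  refine intervalIntegral.integral_congr fun x _ => ?_
  simp only [norm_mul, norm_fourier_coe, one_mul]

/-- **Decay of the modes of a `C²` periodic function**: for `T`-periodic `f` with two derivatives, `f″` continuous,
and `n ≠ 0`, `‖modeCoeff T n f‖ ≤ (T/(2πn))² · ∫₀ᵀ ‖f″‖` (two periodic integrations by parts).
[cite: Katznelson2004, Ch. I §4.4 Theorem] -/
theorem norm_modeCoeff_le_of_hasDerivAt_two [hT : Fact (0 < T)] {f f' f'' : ℝ → ℂ}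
    (hf : ∀ x, HasDerivAt f (f' x) x) (hf' : ∀ x, HasDerivAt f' (f'' x) x) (hf'' : Continuous f'')
    (hper : Function.Periodic f T) {n : ℤ} (hn : n ≠ 0) :
    ‖modeCoeff T n f‖ ≤ (T / (2 * π * n)) ^ 2 * ∫ x in (0 : ℝ)..T, ‖f'' x‖ := by
  have hper' : Function.Periodic f' T := periodic_of_hasDerivAt hf hper
  have hT0 : f T = f 0 := by simpa using hper 0
  have hT0' : f' T = f' 0 := by simpa using hper' 0
  have h := modeCoeff_hasDerivAt_hasDerivAt_eq (T := T) n (fun x _ => hf x) (fun x _ => hf' x)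
    (hf''.intervalIntegrable _ _) hT0 hT0'
  have hq : (0 : ℝ) < (2 * π * n / T) ^ 2 := by
    have : (2 * π * n / T : ℝ) ≠ 0 := by
      have hπ := Real.pi_pos
      have hTp := hT.out
      have hn' : (n : ℝ) ≠ 0 := by exact_mod_cast hn
      positivity
    positivity
  set q : ℝ := (2 * π * n / T) ^ 2 with hqdef
  have key : modeCoeff T n f = -(modeCoeff T n f'' / (q : ℂ)) := by
    rw [h]
    have : (q : ℂ) ≠ 0 := by exact_mod_cast hq.ne'
    field_simp
  rw [key, norm_neg, norm_div, Complex.norm_real, Real.norm_of_nonneg hq.le]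
  have hI := norm_modeCoeff_le_integral_norm hT.out.le n f''
  have hTn : (T / (2 * π * n)) ^ 2 = q⁻¹ := by
    rw [hqdef, ← inv_pow, inv_div]
  rw [hTn, div_eq_inv_mul]
  exact mul_le_mul_of_nonneg_left hI (inv_nonneg.mpr hq.le)

/-- **The modes of a `C²` periodic function are absolutely summable.** [cite: Katznelson2004, Ch. I §4.4 Theorem] -/
theorem summable_norm_modeCoeff_of_hasDerivAt_two [hT : Fact (0 < T)] {f f' f'' : ℝ → ℂ}
    (hf : ∀ x, HasDerivAt f (f' x) x) (hf' : ∀ x, HasDerivAt f' (f'' x) x) (hf'' : Continuous f'')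
    (hper : Function.Periodic f T) : Summable fun n : ℤ => ‖modeCoeff T n f‖ := by
  set M := ∫ x in (0 : ℝ)..T, ‖f'' x‖ with hM
  have hg : Summable fun n : ℤ => (T / (2 * π)) ^ 2 * M * (1 / (n : ℝ) ^ 2) :=
    (Real.summable_one_div_int_pow.mpr one_lt_two).mul_left ((T / (2 * π)) ^ 2 * M)
  refine Summable.of_norm_bounded_eventually hg ?_
  filter_upwards [eventually_cofinite_ne 0] with n hn
  rw [norm_norm]
  calc ‖modeCoeff T n f‖ ≤ (T / (2 * π * n)) ^ 2 * M := norm_modeCoeff_le_of_hasDerivAt_two hf hf' hf'' hper hn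
    _ = (T / (2 * π)) ^ 2 * M * (1 / (n : ℝ) ^ 2) := by
        have hn' : (n : ℝ) ≠ 0 := by exact_mod_cast hn
        field_simp

/-! ### Modes of a product -/

/-- **The modes of a product are the convolution of the modes.** For `f` continuous `T`-periodic with absolutely
summable window modes and `g` continuous,
`Σ_{l ∈ ℤ} modeCoeff T l f · modeCoeff T (m − l) g = T · modeCoeff T m (f · g)`
(insert the pointwise inversion of `f`, integrate termwise by dominated convergence on the window, and use
`e_{−m} e_l = e_{−(m−l)}`). [cite: Katznelson2004, Ch. I §6.1 Lemma] -/
theorem hasSum_modeCoeff_mul [hT : Fact (0 < T)] {f g : ℝ → ℂ} (hf : Continuous f)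
    (hper : Function.Periodic f T) (hs : Summable fun n : ℤ => ‖modeCoeff T n f‖) (hg : Continuous g)
    (m : ℤ) :
    HasSum (fun l : ℤ => modeCoeff T l f * modeCoeff T (m - l) g)
      ((T : ℂ) * modeCoeff T m (fun x => f x * g x)) := by
  have hTpos := hT.out
  -- a bound for `g` on the window
  obtain ⟨G, hG⟩ := (isCompact_uIcc (a := (0:ℝ)) (b := T)).exists_bound_of_continuousOn hg.norm.continuousOn
  -- the termwise integrands
  set Φ : ℤ → ℝ → ℂ := fun l x =>
    ((1 / T : ℝ) : ℂ) * modeCoeff T l f * (fourier (-(m - l)) (x : AddCircle T) * g x) with hΦ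
  have hΦc : ∀ l, Continuous (Φ l) := fun l =>
    continuous_const.mul ((continuous_fourier_coe _).mul hg)
  have hlim : ∀ x : ℝ, HasSum (fun l => Φ l x) (fourier (-m) (x : AddCircle T) * (f x * g x)) := by
    intro x
    have h1 := (hasSum_modeCoeff_mul_fourier hf hper hs x).mul_left (fourier (-m) (x : AddCircle T) * g x)
    have h2 : (fun l : ℤ => fourier (-m) (x : AddCircle T) * g x
        * (((1 / T : ℝ) : ℂ) * modeCoeff T l f * fourier l (x : AddCircle T))) = fun l => Φ l x := by
      funext l
      simp only [hΦ]
      rw [← fourier_neg_mul_fourier m l x]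
      ring
    rw [h2] at h1
    have h3 : fourier (-m) (x : AddCircle T) * g x * f x = fourier (-m) (x : AddCircle T) * (f x * g x) := by
      ring
    rw [h3] at h1
    exact h1
  -- dominated convergence on the window
  have hdom := intervalIntegral.hasSum_integral_of_dominated_convergence (μ := volume) (a := 0) (b := T)
    (F := Φ) (f := fun x => fourier (-m) (x : AddCircle T) * (f x * g x))
    (fun l _ => (1 / T) * ‖modeCoeff T l f‖ * G)
    (fun l => (hΦc l).aestronglyMeasurable)
    (fun l => ae_of_all _ fun x hx => by
      have hx' : x ∈ uIcc (0:ℝ) T := uIoc_subset_uIcc hx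
      have hgx : ‖g x‖ ≤ G := by have := hG x hx'; rwa [norm_norm] at this
      simp only [hΦ, norm_mul, norm_fourier_coe, one_mul, Complex.norm_real, Real.norm_eq_abs,
        abs_of_pos (by positivity : (0:ℝ) < 1 / T)]
      gcongr)
    (ae_of_all _ fun x _ => (hs.mul_left (1 / T)).mul_right G)
    (intervalIntegrable_const (μ := volume) (a := (0:ℝ)) (b := T)
      (c := ∑' l : ℤ, (1 / T) * ‖modeCoeff T l f‖ * G))
    (ae_of_all _ fun x _ => hlim x)
  -- identify the termwise integrals and the limit integral
  have hterm : ∀ l : ℤ, (∫ x in (0 : ℝ)..T, Φ l x)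
      = ((1 / T : ℝ) : ℂ) * (modeCoeff T l f * modeCoeff T (m - l) g) := by
    intro l
    simp only [hΦ, modeCoeff]
    rw [intervalIntegral.integral_const_mul]
    ring
  simp_rw [hterm] at hdom
  have hdom' := hdom.mul_left (T : ℂ)
  have hT0 : (T : ℂ) ≠ 0 := by exact_mod_cast hTpos.ne'
  have hfun : (fun l : ℤ => (T : ℂ) * (((1 / T : ℝ) : ℂ) * (modeCoeff T l f * modeCoeff T (m - l) g)))
      = fun l => modeCoeff T l f * modeCoeff T (m - l) g := by
    funext l; push_cast; field_simp
  rw [hfun] at hdom'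
  exact hdom'

/-! ### Differentiation and continuity in a parameter on an interval -/

/-- **Differentiation of modes in a parameter, local version** (under the integral sign, with hypotheses on an open
parameter interval only): if `θ ↦ G θ φ` has derivative `Gθ θ φ` for all `θ ∈ (a, b)` and all `φ`, each `G θ`
(`θ ∈ (a,b)`) is continuous, and `Gθ` is jointly continuous on `(a, b) × ℝ`, then at every `θ₀ ∈ (a, b)`
`d/dθ ∫₀ᵀ e_{−m} G θ = ∫₀ᵀ e_{−m} Gθ θ₀`. [cite: Folland1999, Thm. 2.27 (b) (differentiation under the integral sign)] -/
theorem hasDerivAt_modeCoeff_param_of_mem_Ioo (m : ℤ) {G Gθ : ℝ → ℝ → ℂ} {a b θ₀ : ℝ} (hθ₀ : θ₀ ∈ Ioo a b)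
    (hd : ∀ θ ∈ Ioo a b, ∀ φ, HasDerivAt (fun θ => G θ φ) (Gθ θ φ) θ)
    (hc : ∀ θ ∈ Ioo a b, Continuous (G θ))
    (hcθ : ContinuousOn (Function.uncurry Gθ) (Ioo a b ×ˢ univ)) :
    HasDerivAt (fun θ => modeCoeff T m (G θ)) (modeCoeff T m (Gθ θ₀)) θ₀ := by
  have he : Continuous fun φ : ℝ => fourier (-m) (φ : AddCircle T) := continuous_fourier_coe (-m)
  -- a compact parameter box inside `(a, b)`
  set δ : ℝ := min (θ₀ - a) (b - θ₀) / 2 with hδ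
  have hδpos : 0 < δ := by
    have h1 : 0 < θ₀ - a := by linarith [hθ₀.1]
    have h2 : 0 < b - θ₀ := by linarith [hθ₀.2]
    rw [hδ]; exact div_pos (lt_min h1 h2) two_pos
  have hδa : a < θ₀ - δ := by
    have : δ < θ₀ - a := by
      rw [hδ]; linarith [min_le_left (θ₀ - a) (b - θ₀), show 0 < θ₀ - a by linarith [hθ₀.1]]
    linarith
  have hδb : θ₀ + δ < b := by
    have : δ < b - θ₀ := by
      rw [hδ]; linarith [min_le_right (θ₀ - a) (b - θ₀), show 0 < b - θ₀ by linarith [hθ₀.2]]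
    linarith
  set s : Set ℝ := Icc (θ₀ - δ) (θ₀ + δ) with hs
  have hsIoo : s ⊆ Ioo a b := fun θ hθ => ⟨lt_of_lt_of_le hδa hθ.1, lt_of_le_of_lt hθ.2 hδb⟩
  have hs_nhds : s ∈ 𝓝 θ₀ := Icc_mem_nhds (by linarith) (by linarith)
  -- a uniform bound for the derivative integrand on the box `s × [0, T]`
  have hK : IsCompact (s ×ˢ uIcc (0 : ℝ) T) := isCompact_Icc.prod isCompact_uIcc
  have hKsub : s ×ˢ uIcc (0 : ℝ) T ⊆ Ioo a b ×ˢ univ := prod_mono hsIoo (subset_univ _)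
  obtain ⟨C, hC⟩ := hK.exists_bound_of_continuousOn
    (((he.norm.comp continuous_snd).continuousOn).mul (hcθ.mono hKsub).norm)
  have hF : ∀ θ ∈ Ioo a b, Continuous fun φ : ℝ => fourier (-m) (φ : AddCircle T) * G θ φ :=
    fun θ hθ => he.mul (hc θ hθ)
  have hF'θ₀ : Continuous fun φ : ℝ => fourier (-m) (φ : AddCircle T) * Gθ θ₀ φ := by
    refine he.mul ?_
    exact hcθ.comp_continuous (continuous_const.prodMk continuous_id) fun φ => ⟨hθ₀, mem_univ _⟩
  have h := intervalIntegral.hasDerivAt_integral_of_dominated_loc_of_deriv_le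
    (F := fun (θ : ℝ) (φ : ℝ) => fourier (-m) (φ : AddCircle T) * G θ φ)
    (F' := fun (θ : ℝ) (φ : ℝ) => fourier (-m) (φ : AddCircle T) * Gθ θ φ) (x₀ := θ₀)
    (s := s) (bound := fun _ => C) (μ := volume) (a := 0) (b := T)
    hs_nhds
    (by
      filter_upwards [Ioo_mem_nhds hθ₀.1 hθ₀.2] with θ hθ
      exact (hF θ hθ).aestronglyMeasurable)
    ((hF θ₀ hθ₀).intervalIntegrable _ _) hF'θ₀.aestronglyMeasurable
    (ae_of_all _ fun φ hφ θ hθ => by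
      have := hC (θ, φ) ⟨hθ, uIoc_subset_uIcc hφ⟩
      simpa [norm_mul] using this)
    intervalIntegrable_const
    (ae_of_all _ fun φ _ θ hθ => (hd θ (hsIoo hθ) φ).const_mul _)
  exact h.2

/-- **Continuity of modes in a parameter on a closed interval**: if `G` is jointly continuous on `[a, b] × ℝ` then
`θ ↦ ∫₀ᵀ e_{−m} G θ` is continuous on `[a, b]` (clamp the parameter to `[a, b]` and use the continuity of parametric
interval integrals). [cite: Folland1999, Thm. 2.27 (a) (continuity under the integral sign)] -/
theorem continuousOn_modeCoeff_param (m : ℤ) {G : ℝ → ℝ → ℂ} {a b : ℝ} (hab : a ≤ b)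
    (hc : ContinuousOn (Function.uncurry G) (Icc a b ×ˢ univ)) :
    ContinuousOn (fun θ => modeCoeff T m (G θ)) (Icc a b) := by
  have he : Continuous fun φ : ℝ => fourier (-m) (φ : AddCircle T) := continuous_fourier_coe (-m)
  -- the clamped integrand is globally jointly continuous
  set Gc : ℝ → ℝ → ℂ := fun θ φ => G (projIcc a b hab θ) φ with hGc
  have hGcc : Continuous (Function.uncurry Gc) := by
    have h1 : Continuous fun p : ℝ × ℝ => ((projIcc a b hab p.1 : ℝ), p.2) :=
      (continuous_subtype_val.comp (continuous_projIcc.comp continuous_fst)).prodMk continuous_snd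
    have h2 := hc.comp_continuous h1 fun p => ⟨(projIcc a b hab p.1).2, mem_univ _⟩
    exact h2
  have hFc : Continuous (Function.uncurry fun (θ : ℝ) (φ : ℝ) => fourier (-m) (φ : AddCircle T) * Gc θ φ) :=
    (he.comp continuous_snd).mul hGcc
  have hcont : Continuous fun θ => modeCoeff T m (Gc θ) := by
    unfold modeCoeff
    exact intervalIntegral.continuous_parametric_intervalIntegral_of_continuous' hFc 0 T
  refine hcont.continuousOn.congr fun θ hθ => ?_
  simp only [hGc]
  rw [projIcc_of_mem hab hθ]

end Literature.Analysis.Fourier
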